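import Summits.ValiantsHypothesis.ValiantsHypothesis.Theorems.SymPencilPerFourPeeledCornerSwap

/-!
# Route `SymPencil` — `2 | 2` inner rank of `per_4`, PEELED case at `≤ 11` squares: the
# GENERALIZED-SWAP CORNER on two DIFFERENT pairs — the twelve independent vectors (`--supports`
# stmt-ValiantsHypothesis-5674 `SdcSuperquadratic`; (8,8) column, cell (8,8,11); memo
# `NOTE-p6g16-5674-corner-double-swap.md` §1 and `NOTE-p8g15-5674-R2-two-pencil.md` §9.6
# "the one known gap"; rung currency only)

The coverage programme for (8,8,11) (memo `NOTE-p8g15…` §9) may leave, besides the pure swap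
`λ(E_ij + E_ji)`, the GENERALIZED swaps `u E_ij + w E_ji` (`u ≠ w`) with an exceptional ratio
frameless; these must then be killed by the corner (rank) method together with the pure swap.  This
file is `…CornerSwapPairsVectors` with four parameters: vectors `N b y, M a z, v₀, v₀'` in `K^κ`,
weights `c`, cross pairings
`⟨M_az, N_by⟩ = ½[a,b,y,z distinct] − (u₀[a=0][y=1] + w₀[a=1][y=0])·(u₁[b=k][z=l] + w₁[b=l][z=k])·λ`
(`ψ = u₀E₀₁ + w₀E₁₀`, `ψ' = u₁E_kl + w₁E_lk`, `λ = ⟨v₀,v₀'⟩`), `N, M ⟂ v₀, v₀'`, `v₀, v₀'` isotropic,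
`u₀w₀u₁w₁λ ≠ 0`.  For the two representative different pairs `(k,l) = (2,3)` and `(0,2)` ten `N`'s
with `v₀, v₀'` are linearly independent (`linearIndependent_twelve_genswap23 / _genswap02`): the
supports are those of the pure case, the pivots are `−λ·(product of two of u₀,w₀,u₁,w₁)` and
`2 × 2` blocks `[[½ − λc, ½],[½, ½]]` of determinant `−λc/4`.  So `12 ≤ |κ|`.

Honest framing: corner bookkeeping; no cell closes; `28 ≤ sdc(per_4) ≤ 29` of record, the crux
`SdcSuperquadratic` and `VP ≠ VNP` untouched.  No definitions, no named facts. [folklore]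
-/

noncomputable section

-- single-conjunct layout: Sub = Summit, duplicated namespace component intended
set_option linter.dupNamespace false

namespace Summit.ValiantsHypothesis.ValiantsHypothesis.Theorems.SymPencilPerFourPeeledCornerGenSwapPairsVectors

open Matrix Finset Module

universe u v

variable {K : Type u} [Field K]

/-- **Twelve independent vectors** for the generalized-swap corner `ψ = u₀E₀₁ + w₀E₁₀`,
`ψ' = u₁E_{23} + w₁E_{32}` (different pairs): the ten `N`'s
`N20, N02, N21, N12, N30, N03, N31, N13, N01, N23` together with `v₀, v₀'`. [folklore] -/
theorem linearIndependent_twelve_genswap23 [CharZero K] {κ : Type v} [Fintype κ] [DecidableEq κ]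
    (c : κ → K) (N M : Fin 4 → Fin 4 → κ → K) (v₀ v₀' : κ → K) (u₀ w₀ u₁ w₁ lam : K)
    (hMN : ∀ a b y z : Fin 4, ∑ r, c r * M a z r * N b y r =
      (if (a ≠ b ∧ a ≠ y ∧ a ≠ z ∧ b ≠ y ∧ b ≠ z ∧ y ≠ z) then (1 / 2 : K) else 0) -
      (u₀ * (Pi.single a 1 : Fin 4 → K) 0 * (Pi.single y 1 : Fin 4 → K) 1 +
        w₀ * (Pi.single a 1 : Fin 4 → K) 1 * (Pi.single y 1 : Fin 4 → K) 0) *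
      (u₁ * (Pi.single b 1 : Fin 4 → K) 2 * (Pi.single z 1 : Fin 4 → K) 3 +
        w₁ * (Pi.single b 1 : Fin 4 → K) 3 * (Pi.single z 1 : Fin 4 → K) 2) * lam)
    (hMv0 : ∀ a z : Fin 4, ∑ r, c r * M a z r * v₀ r = 0)
    (hMv0' : ∀ a z : Fin 4, ∑ r, c r * M a z r * v₀' r = 0)
    (hv0N : ∀ b y : Fin 4, ∑ r, c r * v₀ r * N b y r = 0)
    (hv0'N : ∀ b y : Fin 4, ∑ r, c r * v₀' r * N b y r = 0)
    (hv0v0 : ∑ r, c r * v₀ r * v₀ r = 0) (hv0'v0' : ∑ r, c r * v₀' r * v₀' r = 0)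
    (hv0v0' : ∑ r, c r * v₀ r * v₀' r = lam) (hv0'v0 : ∑ r, c r * v₀' r * v₀ r = lam)
    (hu₀ : u₀ ≠ 0) (hw₀ : w₀ ≠ 0) (hu₁ : u₁ ≠ 0) (hw₁ : w₁ ≠ 0) (hlam : lam ≠ 0) :
    LinearIndependent K (![N 2 0, N 0 2, N 2 1, N 1 2, N 3 0, N 0 3, N 3 1, N 1 3, N 0 1, N 2 3, v₀, v₀'] : Fin 12 → κ → K) := by
  classical
  rw [Fintype.linearIndependent_iff]
  intro g hg
  have key : ∀ τ : κ → K, ∑ j, g j * ∑ r, c r * τ r * (![N 2 0, N 0 2, N 2 1, N 1 2, N 3 0, N 0 3, N 3 1, N 1 3, N 0 1, N 2 3, v₀, v₀'] : Fin 12 → κ → K) j r = 0 := by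
    intro τ
    have e : ∑ j, g j * ∑ r, c r * τ r * (![N 2 0, N 0 2, N 2 1, N 1 2, N 3 0, N 0 3, N 3 1, N 1 3, N 0 1, N 2 3, v₀, v₀'] : Fin 12 → κ → K) j r =
        ∑ r, c r * τ r * (∑ j, g j • (![N 2 0, N 0 2, N 2 1, N 1 2, N 3 0, N 0 3, N 3 1, N 1 3, N 0 1, N 2 3, v₀, v₀'] : Fin 12 → κ → K) j) r := by
      simp only [Finset.sum_apply, Pi.smul_apply, smul_eq_mul, Finset.mul_sum]
      rw [Finset.sum_comm]
      exact Finset.sum_congr rfl fun r _ => Finset.sum_congr rfl fun j _ => by ring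
    rw [e, hg]
    simp
  have T01 : g 9 = 0 := by
    have h := key (M 0 1)
    simpa [Fin.sum_univ_succ, Matrix.cons_val_zero, Matrix.cons_val_succ, hMN, hMv0, hMv0', hu₀, hw₀,
      hu₁, hw₁, hlam] using h
  have T02 : g 6 * ((1 / 2 : K) + (-(lam * u₀ * w₁))) + g 7 * ((1 / 2 : K)) = 0 := by
    have h := key (M 0 2)
    simp [Fin.sum_univ_succ, Matrix.cons_val_zero, Matrix.cons_val_succ, hMN, hMv0, hMv0',
      -mul_eq_zero] at h
    linear_combination h
  have T03 : g 2 * ((1 / 2 : K) + (-(lam * u₀ * u₁))) + g 3 * ((1 / 2 : K)) = 0 := by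
    have h := key (M 0 3)
    simp [Fin.sum_univ_succ, Matrix.cons_val_zero, Matrix.cons_val_succ, hMN, hMv0, hMv0',
      -mul_eq_zero] at h
    linear_combination h
  have T12 : g 4 * ((1 / 2 : K) + (-(lam * w₀ * w₁))) + g 5 * ((1 / 2 : K)) = 0 := by
    have h := key (M 1 2)
    simp [Fin.sum_univ_succ, Matrix.cons_val_zero, Matrix.cons_val_succ, hMN, hMv0, hMv0',
      -mul_eq_zero] at h
    linear_combination h
  have T13 : g 0 * ((1 / 2 : K) + (-(lam * u₁ * w₀))) + g 1 * ((1 / 2 : K)) = 0 := by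
    have h := key (M 1 3)
    simp [Fin.sum_univ_succ, Matrix.cons_val_zero, Matrix.cons_val_succ, hMN, hMv0, hMv0',
      -mul_eq_zero] at h
    linear_combination h
  have T20 : g 6 * ((1 / 2 : K)) + g 7 * ((1 / 2 : K)) = 0 := by
    have h := key (M 2 0)
    simp [Fin.sum_univ_succ, Matrix.cons_val_zero, Matrix.cons_val_succ, hMN, hMv0, hMv0',
      -mul_eq_zero] at h
    linear_combination h
  have T21 : g 4 * ((1 / 2 : K)) + g 5 * ((1 / 2 : K)) = 0 := by
    have h := key (M 2 1)
    simp [Fin.sum_univ_succ, Matrix.cons_val_zero, Matrix.cons_val_succ, hMN, hMv0, hMv0',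
      -mul_eq_zero] at h
    linear_combination h
  have T23 : g 8 = 0 := by
    have h := key (M 2 3)
    simpa [Fin.sum_univ_succ, Matrix.cons_val_zero, Matrix.cons_val_succ, hMN, hMv0, hMv0', hu₀, hw₀,
      hu₁, hw₁, hlam] using h
  have T30 : g 2 * ((1 / 2 : K)) + g 3 * ((1 / 2 : K)) = 0 := by
    have h := key (M 3 0)
    simp [Fin.sum_univ_succ, Matrix.cons_val_zero, Matrix.cons_val_succ, hMN, hMv0, hMv0',
      -mul_eq_zero] at h
    linear_combination h
  have T31 : g 0 * ((1 / 2 : K)) + g 1 * ((1 / 2 : K)) = 0 := by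
    have h := key (M 3 1)
    simp [Fin.sum_univ_succ, Matrix.cons_val_zero, Matrix.cons_val_succ, hMN, hMv0, hMv0',
      -mul_eq_zero] at h
    linear_combination h
  have Tv0p : g 10 = 0 := by
    have h := key v₀'
    simpa [Fin.sum_univ_succ, Matrix.cons_val_zero, Matrix.cons_val_succ, hv0'N, hv0'v0, hv0'v0',
      hlam] using h
  have Tv0 : g 11 = 0 := by
    have h := key v₀
    simpa [Fin.sum_univ_succ, Matrix.cons_val_zero, Matrix.cons_val_succ, hv0N, hv0v0, hv0v0',
      hlam] using h
  have hg10 : g 10 = 0 := Tv0p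
  have hg11 : g 11 = 0 := Tv0
  have hg9 : g 9 = 0 := T01
  have hg8 : g 8 = 0 := T23
  have hg6 : g 6 = 0 := by
    have h : g 6 * (lam * u₀ * w₁) = 0 := by linear_combination (((-1) : K)) * T02 + ((1 : K)) * T20
    exact (mul_eq_zero.1 h).resolve_right (mul_ne_zero (mul_ne_zero hlam hu₀) hw₁)
  have hg7 : g 7 = 0 := by linear_combination ((2 : K)) * T02 + (((-1) : K) + ((2 : K) * (lam * u₀ * w₁))) * hg6
  have hg2 : g 2 = 0 := by
    have h : g 2 * (lam * u₀ * u₁) = 0 := by linear_combination (((-1) : K)) * T03 + ((1 : K)) * T30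
    exact (mul_eq_zero.1 h).resolve_right (mul_ne_zero (mul_ne_zero hlam hu₀) hu₁)
  have hg3 : g 3 = 0 := by linear_combination ((2 : K)) * T03 + (((-1) : K) + ((2 : K) * (lam * u₀ * u₁))) * hg2
  have hg4 : g 4 = 0 := by
    have h : g 4 * (lam * w₀ * w₁) = 0 := by linear_combination (((-1) : K)) * T12 + ((1 : K)) * T21
    exact (mul_eq_zero.1 h).resolve_right (mul_ne_zero (mul_ne_zero hlam hw₀) hw₁)
  have hg5 : g 5 = 0 := by linear_combination ((2 : K)) * T12 + (((-1) : K) + ((2 : K) * (lam * w₀ * w₁))) * hg4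
  have hg0 : g 0 = 0 := by
    have h : g 0 * (lam * u₁ * w₀) = 0 := by linear_combination (((-1) : K)) * T13 + ((1 : K)) * T31
    exact (mul_eq_zero.1 h).resolve_right (mul_ne_zero (mul_ne_zero hlam hu₁) hw₀)
  have hg1 : g 1 = 0 := by linear_combination ((2 : K)) * T13 + (((-1) : K) + ((2 : K) * (lam * u₁ * w₀))) * hg0
  intro i
  fin_cases i <;> assumption

/-- **Twelve independent vectors** for the generalized-swap corner `ψ = u₀E₀₁ + w₀E₁₀`,
`ψ' = u₁E_{02} + w₁E_{20}` (different pairs): the ten `N`'s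
`N00, N21, N01, N20, N10, N02, N03, N12, N13, N23` together with `v₀, v₀'`. [folklore] -/
theorem linearIndependent_twelve_genswap02 [CharZero K] {κ : Type v} [Fintype κ] [DecidableEq κ]
    (c : κ → K) (N M : Fin 4 → Fin 4 → κ → K) (v₀ v₀' : κ → K) (u₀ w₀ u₁ w₁ lam : K)
    (hMN : ∀ a b y z : Fin 4, ∑ r, c r * M a z r * N b y r =
      (if (a ≠ b ∧ a ≠ y ∧ a ≠ z ∧ b ≠ y ∧ b ≠ z ∧ y ≠ z) then (1 / 2 : K) else 0) -
      (u₀ * (Pi.single a 1 : Fin 4 → K) 0 * (Pi.single y 1 : Fin 4 → K) 1 +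
        w₀ * (Pi.single a 1 : Fin 4 → K) 1 * (Pi.single y 1 : Fin 4 → K) 0) *
      (u₁ * (Pi.single b 1 : Fin 4 → K) 0 * (Pi.single z 1 : Fin 4 → K) 2 +
        w₁ * (Pi.single b 1 : Fin 4 → K) 2 * (Pi.single z 1 : Fin 4 → K) 0) * lam)
    (hMv0 : ∀ a z : Fin 4, ∑ r, c r * M a z r * v₀ r = 0)
    (hMv0' : ∀ a z : Fin 4, ∑ r, c r * M a z r * v₀' r = 0)
    (hv0N : ∀ b y : Fin 4, ∑ r, c r * v₀ r * N b y r = 0)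
    (hv0'N : ∀ b y : Fin 4, ∑ r, c r * v₀' r * N b y r = 0)
    (hv0v0 : ∑ r, c r * v₀ r * v₀ r = 0) (hv0'v0' : ∑ r, c r * v₀' r * v₀' r = 0)
    (hv0v0' : ∑ r, c r * v₀ r * v₀' r = lam) (hv0'v0 : ∑ r, c r * v₀' r * v₀ r = lam)
    (hu₀ : u₀ ≠ 0) (hw₀ : w₀ ≠ 0) (hu₁ : u₁ ≠ 0) (hw₁ : w₁ ≠ 0) (hlam : lam ≠ 0) :
    LinearIndependent K (![N 0 0, N 2 1, N 0 1, N 2 0, N 1 0, N 0 2, N 0 3, N 1 2, N 1 3, N 2 3, v₀, v₀'] : Fin 12 → κ → K) := by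
  classical
  rw [Fintype.linearIndependent_iff]
  intro g hg
  have key : ∀ τ : κ → K, ∑ j, g j * ∑ r, c r * τ r * (![N 0 0, N 2 1, N 0 1, N 2 0, N 1 0, N 0 2, N 0 3, N 1 2, N 1 3, N 2 3, v₀, v₀'] : Fin 12 → κ → K) j r = 0 := by
    intro τ
    have e : ∑ j, g j * ∑ r, c r * τ r * (![N 0 0, N 2 1, N 0 1, N 2 0, N 1 0, N 0 2, N 0 3, N 1 2, N 1 3, N 2 3, v₀, v₀'] : Fin 12 → κ → K) j r =
        ∑ r, c r * τ r * (∑ j, g j • (![N 0 0, N 2 1, N 0 1, N 2 0, N 1 0, N 0 2, N 0 3, N 1 2, N 1 3, N 2 3, v₀, v₀'] : Fin 12 → κ → K) j) r := by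
      simp only [Finset.sum_apply, Pi.smul_apply, smul_eq_mul, Finset.mul_sum]
      rw [Finset.sum_comm]
      exact Finset.sum_congr rfl fun r _ => Finset.sum_congr rfl fun j _ => by ring
    rw [e, hg]
    simp
  have T00 : g 1 = 0 := by
    have h := key (M 0 0)
    simpa [Fin.sum_univ_succ, Matrix.cons_val_zero, Matrix.cons_val_succ, hMN, hMv0, hMv0', hu₀, hw₀,
      hu₁, hw₁, hlam] using h
  have T01 : g 9 = 0 := by
    have h := key (M 0 1)
    simpa [Fin.sum_univ_succ, Matrix.cons_val_zero, Matrix.cons_val_succ, hMN, hMv0, hMv0', hu₀, hw₀,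
      hu₁, hw₁, hlam] using h
  have T02 : g 2 * ((-(lam * u₀ * u₁))) + g 8 * ((1 / 2 : K)) = 0 := by
    have h := key (M 0 2)
    simp [Fin.sum_univ_succ, Matrix.cons_val_zero, Matrix.cons_val_succ, hMN, hMv0, hMv0',
      -mul_eq_zero] at h
    linear_combination h
  have T03 : g 1 * ((1 / 2 : K)) + g 7 * ((1 / 2 : K)) = 0 := by
    have h := key (M 0 3)
    simp [Fin.sum_univ_succ, Matrix.cons_val_zero, Matrix.cons_val_succ, hMN, hMv0, hMv0',
      -mul_eq_zero] at h
    linear_combination h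
  have T10 : g 3 * ((-(lam * w₀ * w₁))) + g 9 * ((1 / 2 : K)) = 0 := by
    have h := key (M 1 0)
    simp [Fin.sum_univ_succ, Matrix.cons_val_zero, Matrix.cons_val_succ, hMN, hMv0, hMv0',
      -mul_eq_zero] at h
    linear_combination h
  have T12 : g 0 * ((-(lam * u₁ * w₀))) + g 6 * ((1 / 2 : K)) = 0 := by
    have h := key (M 1 2)
    simp [Fin.sum_univ_succ, Matrix.cons_val_zero, Matrix.cons_val_succ, hMN, hMv0, hMv0',
      -mul_eq_zero] at h
    linear_combination h
  have T13 : g 3 * ((1 / 2 : K)) + g 5 * ((1 / 2 : K)) = 0 := by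
    have h := key (M 1 3)
    simp [Fin.sum_univ_succ, Matrix.cons_val_zero, Matrix.cons_val_succ, hMN, hMv0, hMv0',
      -mul_eq_zero] at h
    linear_combination h
  have T20 : g 8 = 0 := by
    have h := key (M 2 0)
    simpa [Fin.sum_univ_succ, Matrix.cons_val_zero, Matrix.cons_val_succ, hMN, hMv0, hMv0', hu₀, hw₀,
      hu₁, hw₁, hlam] using h
  have T21 : g 6 = 0 := by
    have h := key (M 2 1)
    simpa [Fin.sum_univ_succ, Matrix.cons_val_zero, Matrix.cons_val_succ, hMN, hMv0, hMv0', hu₀, hw₀,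
      hu₁, hw₁, hlam] using h
  have T23 : g 2 * ((1 / 2 : K)) + g 4 * ((1 / 2 : K)) = 0 := by
    have h := key (M 2 3)
    simp [Fin.sum_univ_succ, Matrix.cons_val_zero, Matrix.cons_val_succ, hMN, hMv0, hMv0',
      -mul_eq_zero] at h
    linear_combination h
  have Tv0p : g 10 = 0 := by
    have h := key v₀'
    simpa [Fin.sum_univ_succ, Matrix.cons_val_zero, Matrix.cons_val_succ, hv0'N, hv0'v0, hv0'v0',
      hlam] using h
  have Tv0 : g 11 = 0 := by
    have h := key v₀
    simpa [Fin.sum_univ_succ, Matrix.cons_val_zero, Matrix.cons_val_succ, hv0N, hv0v0, hv0v0',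
      hlam] using h
  have hg10 : g 10 = 0 := Tv0p
  have hg11 : g 11 = 0 := Tv0
  have hg1 : g 1 = 0 := T00
  have hg9 : g 9 = 0 := T01
  have hg7 : g 7 = 0 := by linear_combination ((2 : K)) * T03 + (((-1) : K)) * hg1
  have hg3 : g 3 = 0 := by
    have h : g 3 * (lam * w₀ * w₁) = 0 := by linear_combination (((-1) : K)) * T10 + ((1 / 2 : K)) * hg9
    exact (mul_eq_zero.1 h).resolve_right (mul_ne_zero (mul_ne_zero hlam hw₀) hw₁)
  have hg5 : g 5 = 0 := by linear_combination ((2 : K)) * T13 + (((-1) : K)) * hg3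
  have hg8 : g 8 = 0 := T20
  have hg2 : g 2 = 0 := by
    have h : g 2 * (lam * u₀ * u₁) = 0 := by linear_combination (((-1) : K)) * T02 + ((1 / 2 : K)) * hg8
    exact (mul_eq_zero.1 h).resolve_right (mul_ne_zero (mul_ne_zero hlam hu₀) hu₁)
  have hg6 : g 6 = 0 := T21
  have hg0 : g 0 = 0 := by
    have h : g 0 * (lam * u₁ * w₀) = 0 := by linear_combination (((-1) : K)) * T12 + ((1 / 2 : K)) * hg6
    exact (mul_eq_zero.1 h).resolve_right (mul_ne_zero (mul_ne_zero hlam hu₁) hw₀)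
  have hg4 : g 4 = 0 := by linear_combination ((2 : K)) * T23 + (((-1) : K)) * hg2
  intro i
  fin_cases i <;> assumption

end Summit.ValiantsHypothesis.ValiantsHypothesis.Theorems.SymPencilPerFourPeeledCornerGenSwapPairsVectors

end
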